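import Literature.Topology.FourManifolds.OrientedConnectedSumUniqueness
import Literature.Topology.FourManifolds.OrientedConnectedSumTransportProofs
import Literature.Topology.FourManifolds.HomotopySpheresGroup
import HarnessLib

/-!
# Associativity of the oriented connected sum

Topic `Literature/Topology/FourManifolds`. This file DISCHARGES the named fact
`Literature.Topology.FourManifolds.isOrientedConnectedSum_assoc` of `HomotopySpheresGroup.lean` — leaf (v) "K2" of the
decomposition of Kervaire–Milnor's Theorem 1.1 (`Literature.Topology.FourManifolds.exists_commGroup_homotopySphereClass`):

* `Literature.isOrientedConnectedSum_assoc_holds : isOrientedConnectedSum_assoc` — if `(P₁₂, o₁₂)` is an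
  oriented connected sum `M₁ # M₂`, `(Q, oQ)` one of `P₁₂ # M₃`, `(P₂₃, o₂₃)` one of `M₂ # M₃` and
  `(Q', oQ')` one of `M₁ # P₂₃` (closed connected oriented smooth `n`-manifolds modelled on `ℝⁿ`),
  then `Q ≅ Q'` by an orientation-preserving diffeomorphism
  (Kervaire–Milnor, *Groups of homotopy spheres I* (1963), Lemma 2.1, p. 505: "The connected sum
  operation is well defined, associative, and commutative up to orientation preserving
  diffeomorphism. … The proof is straightforward [and] will make use of the lemma of Palais and
  Cerf"; Kosinski, *Differential Manifolds* (1993), Ch. VI §1).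

## Proof

Kervaire–Milnor leave the proof to the reader; we follow the standard argument (Kosinski VI.1):
by the uniqueness of oriented connected sums up to orientation-preserving diffeomorphism
(`Literature.Topology.FourManifolds.exists_diffeomorph_isOrientationPreserving_of_isOrientedConnectedSum_euclidean`, the
Palais–Cerf disc theorem, `OrientedConnectedSumUniqueness.lean`) and their naturality in the
summands (`Literature.IsOrientedConnectedSum.of_diffeomorph_left/right`), both `Q` and `Q'` may be
replaced by STANDARD models built on chosen discs. For `n ≠ 0` choose charts onto `ℝⁿ`: `e₁` of
`M₁` (its disc fixes the constant orientation `o₀` of `ℝⁿ`), two charts `eb`, `ec` of `M₂` with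
disjoint sources (coordinate balls `B(±c, 1)`, `‖c‖ = 3`, of one chart,
`Literature.Topology.FourManifolds.exists_charts_disjoint_source`) and discs reversing resp. preserving orientation (compose
with a reflection if necessary, `Literature.exists_chart_symm_isOrientationPreserving/Reversing`), and
`e₃` of `M₃` with orientation-reversing disc. The model `T` of `(M₁ # M₂) # M₃` is Kosinski's
glued manifold (`Literature.Topology.FourManifolds.ConnectedSumData.Glued`, `OrientedConnectedSumExistence.lean`) on the discs
`e₁⁻¹, eb⁻¹`, glued again to `M₃` along the disc `jB ∘ ec⁻¹` of `M₁ # M₂` (an open smooth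
embedding through the open piece `M₂ ∖ {eb⁻¹ 0}`, `Literature.Topology.FourManifolds.isSmoothEmbedding_comp_codRestrict`, turned
into a chart by `Literature.Topology.FourManifolds.exists_chart_of_isSmoothEmbedding`) and `e₃⁻¹`; the model `T'` of
`M₁ # (M₂ # M₃)` is the SAME construction for the constant orientation `-o₀` on the discs
`e₃⁻¹, ec⁻¹`, then `jB ∘ eb⁻¹, e₁⁻¹` — a model of `(M₃ # M₂) # M₁`, which by the symmetry of
oriented connected sums (`Literature.Topology.FourManifolds.IsOrientedConnectedSum.symm`) is an oriented sum `M₁ # (M₂ # M₃)`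
(`Literature.Topology.FourManifolds.exists_nested_glued`). Both `T` and `T'` are covered by three open orientation-preserving
smooth embeddings of `M₁ ∖ {e₁⁻¹ 0}`, `M₂ ∖ {eb⁻¹ 0, ec⁻¹ 0}`, `M₃ ∖ {e₃⁻¹ 0}` identifying points
exactly by Kervaire–Milnor's relations for `(e₁⁻¹, eb⁻¹)` and `(ec⁻¹, e₃⁻¹)`, the first and
third pieces being disjoint (`Literature.Topology.FourManifolds.exists_threeCover`; this is where the disjointness of the two
discs of `M₂` enters); the three-piece comparison map (`Literature.Topology.FourManifolds.exists_diffeomorph_comp_eq₃`, two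
steps of Kosinski's VI.(1.1) at once) is then an orientation-preserving diffeomorphism `T ≅ T'`
(`Literature.Topology.FourManifolds.exists_diffeomorph_of_threeCovers`). Finally `Q ≅ T` and `Q' ≅ T'` by uniqueness, applied
on each side once to the inner sum (`P₁₂ ≅ M₁ # M₂`, transported) and once to the outer one.
For `n = 0` the hypotheses are contradictory: a connected `0`-manifold is a point, so the
connected sum `P₁₂` of `M₁`, `M₂` would be empty.

On the way: a criterion for smooth embeddings (`Literature.Topology.FourManifolds.isSmoothEmbedding_of_leftInverse`: an
injective open `C^∞` map with `C^∞` left inverse on its range), and the composition of OPEN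
smooth embeddings through an open submanifold (`Literature.Topology.FourManifolds.isSmoothEmbedding_comp_codRestrict`, the case
of Mathlib's `proof_wanted Manifold.IsSmoothEmbedding.comp` needed here), with its orientation
bookkeeping.

All statements are theorems; no definition and no statement of the tree is changed.

## References

* M. Kervaire, J. Milnor, *Groups of homotopy spheres I*, Ann. of Math. (2) 77 (1963), 504–537,
  §2, Lemma 2.1 (p. 505). doi:10.2307/1970128 [KervaireMilnorAnnals1963]
* A. Kosinski, *Differential Manifolds*, Academic Press (1993), Ch. VI §1, Thm (1.1).
  [Kosinski1993]
* J. M. Lee, *Introduction to Smooth Manifolds*, 2nd ed. (2013), Prop. 5.2, Thm. 4.14 (open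
  embeddings). [Lee2013]
-/

open scoped Manifold ContDiff Topology
open Set Module Function Filter OpenPartialHomeomorph Metric

noncomputable section

namespace Literature.Topology.FourManifolds

/-! ### Open smooth embeddings: a criterion and composition through an open submanifold -/

section EmbeddingCriterion

variable {E H H' H'' : Type*} [NormedAddCommGroup E] [NormedSpace ℝ E] [TopologicalSpace H]
  [TopologicalSpace H'] [TopologicalSpace H''] {I : ModelWithCorners ℝ E H}
  {J : ModelWithCorners ℝ E H'} {K : ModelWithCorners ℝ E H''} [I.Boundaryless] [J.Boundaryless]
  [K.Boundaryless]
  {X : Type*} [TopologicalSpace X] [ChartedSpace H X] [IsManifold I ∞ X]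
  {Y : Type*} [TopologicalSpace Y] [ChartedSpace H' Y] [IsManifold J ∞ Y]
  {Z : Type*} [TopologicalSpace Z] [ChartedSpace H'' Z] [IsManifold K ∞ Z]

omit [K.Boundaryless] [IsManifold K ∞ Z] in
/-- **An injective open `C^∞` map with a `C^∞` left inverse on its range is a smooth
embedding** (equidimensional, boundaryless models): it is then a globally defined partial
diffeomorphism onto its open range (`Literature.Topology.FourManifolds.isSmoothEmbedding_of_openPartialHomeomorph`;
Lee, *Introduction to Smooth Manifolds* (2013), Prop. 5.2 / Thm. 4.14). [folklore] -/
theorem isSmoothEmbedding_of_leftInverse [Nonempty X] {φ : X → Y} (hcont : Continuous φ)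
    (hinj : Injective φ) (hopen : IsOpenMap φ) (hs : ContMDiff I J ∞ φ) {g : Y → X}
    (hg : LeftInverse g φ) (hgs : ContMDiffOn J I ∞ g (range φ)) :
    Manifold.IsSmoothEmbedding I J ∞ φ := by
  have hemb : Topology.IsOpenEmbedding φ := .of_continuous_injective_isOpenMap hcont hinj hopen
  have hsymm : ContMDiffOn J I ∞ (hemb.toOpenPartialHomeomorph φ).symm
      (hemb.toOpenPartialHomeomorph φ).target := by
    rw [hemb.toOpenPartialHomeomorph_target]
    refine hgs.congr fun y hy => ?_
    obtain ⟨x, rfl⟩ := hy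
    rw [hg x]
    exact hemb.toOpenPartialHomeomorph_left_inv
  exact isSmoothEmbedding_of_openPartialHomeomorph (I := I) (J := J) (n := ∞)
    (hemb.toOpenPartialHomeomorph φ) (hemb.toOpenPartialHomeomorph_source)
    (by rw [hemb.toOpenPartialHomeomorph_source]; exact hs.contMDiffOn) hsymm
    (ContinuousLinearEquiv.refl ℝ E)

omit [J.Boundaryless] [IsManifold J ∞ Y] in
/-- **Composition of open smooth embeddings through an open submanifold.** Let `f : X → Y` be a
`C^∞` embedding with open range contained in the open submanifold `U ⊆ Y`, and `ι : U → Z` a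
`C^∞` embedding with open range (all manifolds modelled on the same vector space, boundaryless).
Then `x ↦ ι ⟨f x, _⟩` is a `C^∞` embedding `X → Z` with open range: it is injective, open and
`C^∞`, with the `C^∞` left inverse `f⁻¹ ∘ ι⁻¹` on its range
(`Literature.Topology.FourManifolds.contMDiffOn_leftInverse_of_isImmersion`). This supplies, for open embeddings, the
composition lemma `Manifold.IsSmoothEmbedding.comp` that Mathlib leaves as `proof_wanted`
(Lee, *Introduction to Smooth Manifolds* (2013), Prop. 5.2). [folklore] -/
theorem isSmoothEmbedding_comp_codRestrict [Nonempty X] {f : X → Y}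
    (hf : Manifold.IsSmoothEmbedding I J ∞ f) (hfo : IsOpen (range f))
    {U : TopologicalSpace.Opens Y} (hU : ∀ x, f x ∈ U) {ι : U → Z}
    (hι : Manifold.IsSmoothEmbedding J K ∞ ι) (hιo : IsOpen (range ι)) {φ : X → Z}
    (hφ : ∀ x, φ x = ι ⟨f x, hU x⟩) :
    Manifold.IsSmoothEmbedding I K ∞ φ ∧ IsOpen (range φ) := by
  set c : X → U := fun x => ⟨f x, hU x⟩ with hc_def
  have hφc : φ = ι ∘ c := funext hφ
  have hfemb : Topology.IsOpenEmbedding f := ⟨hf.isEmbedding, hfo⟩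
  have hιemb : Topology.IsOpenEmbedding ι := ⟨hι.isEmbedding, hιo⟩
  have hccont : Continuous c := hf.contMDiff.continuous.subtype_mk _
  have hcinj : Injective c := fun x y h => hf.isEmbedding.injective (congrArg Subtype.val h)
  have hcopen : IsOpenMap c := by
    intro V hV
    have hcV : c '' V = Subtype.val ⁻¹' (f '' V) := by
      ext u
      constructor
      · rintro ⟨x, hx, rfl⟩
        exact ⟨x, hx, rfl⟩
      · rintro ⟨x, hx, hxu⟩
        exact ⟨x, hx, Subtype.ext hxu⟩
    rw [hcV]
    exact (hfemb.isOpenMap V hV).preimage continuous_subtype_val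
  have hcs : ContMDiff I J ∞ c := (ContMDiff.subtypeVal_comp_iff U c).1 hf.contMDiff
  haveI : Nonempty U := ⟨c (Classical.arbitrary X)⟩
  set gf : Y → X := Function.invFun f with hgf_def
  have hgf : LeftInverse gf f := leftInverse_invFun hf.isEmbedding.injective
  set gι : Z → U := Function.invFun ι with hgι_def
  have hgι : LeftInverse gι ι := leftInverse_invFun hι.isEmbedding.injective
  have hgfs : ContMDiffOn J I ∞ gf (range f) :=
    contMDiffOn_leftInverse_of_isImmersion hf.isImmersion hf.isEmbedding hgf
  have hgιs : ContMDiffOn K J ∞ gι (range ι) :=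
    contMDiffOn_leftInverse_of_isImmersion hι.isImmersion hι.isEmbedding hgι
  have hrange : range φ ⊆ range ι := by
    rintro _ ⟨x, rfl⟩
    exact ⟨c x, (hφ x).symm⟩
  have hg : LeftInverse (gf ∘ Subtype.val ∘ gι) φ := fun x => by
    simp only [Function.comp_apply, hφ x]
    rw [hgι]
    exact hgf x
  have hgs : ContMDiffOn K I ∞ (gf ∘ Subtype.val ∘ gι) (range φ) := by
    have h1 : ContMDiffOn K J ∞ (Subtype.val ∘ gι) (range φ) :=
      contMDiff_subtype_val.comp_contMDiffOn (hgιs.mono hrange)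
    refine hgfs.comp h1 ?_
    rintro _ ⟨x, rfl⟩
    simp only [mem_preimage, Function.comp_apply, hφ x]
    rw [hgι]
    exact mem_range_self x
  refine ⟨isSmoothEmbedding_of_leftInverse (hφc ▸ hι.contMDiff.continuous.comp hccont)
    (hφc ▸ hι.isEmbedding.injective.comp hcinj) (hφc ▸ hιemb.isOpenMap.comp hcopen)
    (hφc ▸ hι.contMDiff.comp hcs) hg hgs, ?_⟩
  rw [hφc, range_comp]
  exact hιemb.isOpenMap _ hcopen.isOpen_range

omit [I.Boundaryless] [J.Boundaryless] [K.Boundaryless] in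
/-- **Orientation behaviour of a composite through an open submanifold**: with `f`, `U`, `ι`,
`φ` as in `isSmoothEmbedding_comp_codRestrict`, if `f` preserves the orientations `(oX, oY)` and
`ι` preserves `(oY|U, oZ)`, then `φ = ι ∘ f` preserves `(oX, oZ)` (chain rule; the
corestriction of `f` to `U` has the differential of `f`, `Literature.Topology.FourManifolds.mfderiv_codRestrict_opens_eq`).
Hirsch, *Differential Topology* (1976), §4.4. [folklore] -/
theorem isOrientationPreserving_comp_codRestrict {f : X → Y}
    (hf : Manifold.IsSmoothEmbedding I J ∞ f) (hfo : IsOpen (range f))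
    {U : TopologicalSpace.Opens Y} (hU : ∀ x, f x ∈ U) {ι : U → Z}
    (hι : Manifold.IsSmoothEmbedding J K ∞ ι) (hιo : IsOpen (range ι)) {φ : X → Z}
    (hφ : ∀ x, φ x = ι ⟨f x, hU x⟩) {oX : SmoothOrientation I X} {oY : SmoothOrientation J Y}
    {oZ : SmoothOrientation K Z} (hfor : IsOrientationPreserving oX oY f)
    (hιor : IsOrientationPreserving (oY.restrict U) oZ ι) : IsOrientationPreserving oX oZ φ := by
  set c : X → U := fun x => ⟨f x, hU x⟩ with hc_def
  have hφc : φ = ι ∘ c := funext hφ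
  have hcf : ∀ x, (c x : Y) = f x := fun _ => rfl
  have hfd : ∀ x, MDifferentiableAt I J f x := fun x => (hf.contMDiff x).mdifferentiableAt (by simp)
  have hcd : ∀ x, mfderiv I J c x = mfderiv I J f x := fun x =>
    mfderiv_codRestrict_opens_eq hcf (hfd x)
  rw [hφc]
  refine IsOrientationPreserving.comp_holds hιor (fun x => ?_)
    (fun u => (hι.contMDiff u).mdifferentiableAt (by simp))
    (fun x => mdifferentiableAt_codRestrict_opens hcf (hfd x))
    (fun u => det_mfderiv_ne_zero_of_isSmoothEmbedding hι hιo u) (fun x => ?_)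
  · rw [SmoothOrientation.restrict_apply, hcd x]
    exact hfor x
  · rw [hcd x]
    exact det_mfderiv_ne_zero_of_isSmoothEmbedding hf hfo x

omit [I.Boundaryless] [J.Boundaryless] [K.Boundaryless] [IsManifold J ∞ Y] [IsManifold K ∞ Z] in
/-- The inclusion of an open submanifold preserves the restricted orientation (its differential
is the identity, `Literature.Topology.FourManifolds.det_mfderiv_subtype_val`). [folklore] -/
theorem isOrientationPreserving_subtype_val (o : SmoothOrientation I X)
    (U : TopologicalSpace.Opens X) :
    IsOrientationPreserving (o.restrict U) o (Subtype.val : U → X) := fun x => by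
  rw [det_mfderiv_subtype_val, SmoothOrientation.restrict_apply]
  exact iff_of_true rfl one_pos

end EmbeddingCriterion

/-! ### Coordinate balls of a chart as charts onto the whole model space -/

section BallChart

variable {E : Type*} [NormedAddCommGroup E] [InnerProductSpace ℝ E]
  {M : Type*} [TopologicalSpace M] [ChartedSpace E M] [IsManifold 𝓘(ℝ, E) ∞ M]

/-- **The coordinate ball `e⁻¹(B(c, r))` of a chart onto the model space, as a chart onto the
whole model space**: for `e` in the maximal `C^∞` atlas with `e.target = univ`, the chart
`e ≫ (univBall c r)⁻¹` lies in the maximal atlas, has target `univ`, source `e⁻¹(B(c, r))`, and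
its inverse is the disc `e⁻¹ ∘ univBall c r` (Mathlib's diffeomorphism `univBall c r : E ≅ B(c, r)`).
Used to produce SMALL discs with disjoint images inside one chart (Kosinski, *Differential
Manifolds* (1993), VI.1: "imbeddings `hᵢ : Rᵐ → Mᵢ`" with prescribed disjoint images).
[folklore] -/
theorem exists_chart_ball {e : OpenPartialHomeomorph M E} (he : e ∈ IsManifold.maximalAtlas 𝓘(ℝ, E) ∞ M)
    (het : e.target = univ) (c : E) {r : ℝ} (hr : 0 < r) :
    ∃ e' ∈ IsManifold.maximalAtlas 𝓘(ℝ, E) ∞ M, e'.target = univ ∧ e'.source = e.symm '' ball c r ∧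
      ∀ y, e'.symm y = e.symm (univBall c r y) := by
  set u := univBall c r with hu
  have hut : u.target = ball c r := univBall_target c hr
  have hus : u.source = univ := univBall_source c r
  refine ⟨e ≫ₕ u.symm, ?_, ?_, ?_, fun y => ?_⟩
  · apply OpenPartialHomeomorph.mem_maximalAtlas_of_contMDiffOn
    · rw [trans_source, coe_trans, symm_source, hut]
      exact contDiffOn_univBall_symm.contMDiffOn.comp
        ((contMDiffOn_of_mem_maximalAtlas he).mono inter_subset_left) fun y hy => hy.2
    · rw [trans_symm_eq_symm_trans_symm, symm_symm]
      refine (contMDiffOn_symm_of_mem_maximalAtlas he).comp contDiff_univBall.contMDiff.contMDiffOn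
        fun y _ => ?_
      rw [het]; trivial
  · rw [trans_target, symm_target, hus, univ_inter, eq_univ_iff_forall]
    intro y
    rw [mem_preimage, symm_symm, het]
    trivial
  · rw [trans_source, symm_source, hut]
    ext x
    constructor
    · rintro ⟨hx, hxb⟩
      exact ⟨e x, hxb, e.left_inv hx⟩
    · rintro ⟨y, hy, rfl⟩
      have hyt : y ∈ e.target := by rw [het]; trivial
      exact ⟨e.map_target hyt, by rw [mem_preimage, e.right_inv hyt]; exact hy⟩
  · rfl

omit [InnerProductSpace ℝ E] [ChartedSpace E M] [IsManifold 𝓘(ℝ, E) ∞ M] in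
/-- **Two small discs with disjoint images inside one chart.** If the coordinate balls
`B(c₁, r₁)`, `B(c₂, r₂)` are disjoint, the corresponding discs `e⁻¹ ∘ univBall cᵢ rᵢ` have disjoint
images (`e⁻¹` is injective on `e.target = univ`). [folklore] -/
theorem disjoint_image_symm_ball {e : OpenPartialHomeomorph M E} (het : e.target = univ)
    {c₁ c₂ : E} {r₁ r₂ : ℝ} (h : Disjoint (ball c₁ r₁) (ball c₂ r₂)) :
    Disjoint (e.symm '' ball c₁ r₁) (e.symm '' ball c₂ r₂) := by
  rw [Set.disjoint_iff]
  rintro x ⟨⟨y₁, hy₁, rfl⟩, ⟨y₂, hy₂, hyx⟩⟩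
  have hinj : y₂ = y₁ := e.symm.injOn (by rw [e.symm_source, het]; trivial)
    (by rw [e.symm_source, het]; trivial) hyx
  subst hinj
  exact Set.disjoint_iff.1 h ⟨hy₁, hy₂⟩

end BallChart

/-! ### Charts with prescribed orientation behaviour; disjoint coordinate balls -/

section Charts

variable {n : ℕ}

variable {M : Type*} [TopologicalSpace M] [ChartedSpace (EuclideanSpace ℝ (Fin n)) M] [IsManifold (𝓡 n) ∞ M]

omit [ChartedSpace (EuclideanSpace ℝ (Fin n)) M] [IsManifold (𝓡 n) ∞ M] in
/-- The disc of a chart onto the whole model space has range the (open) source of the chart.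
[folklore] -/
theorem range_symm_of_target_eq_univ {e : OpenPartialHomeomorph M (EuclideanSpace ℝ (Fin n))} (het : e.target = univ) :
    range e.symm = e.source := by
  rw [← e.symm_image_target_eq_source, het, image_univ]

/-- The Jacobian sign of a linear isometry of `ℝⁿ` with `det = -1` is negative, and so is that of
its inverse. [folklore] -/
theorem det_symm_neg_of_det_eq_neg_one {R : (EuclideanSpace ℝ (Fin n)) ≃ₗᵢ[ℝ] (EuclideanSpace ℝ (Fin n))}
    (hR : LinearMap.det (R.toLinearEquiv : (EuclideanSpace ℝ (Fin n)) →ₗ[ℝ] (EuclideanSpace ℝ (Fin n))) = -1) :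
    LinearMap.det (R.symm.toLinearEquiv : (EuclideanSpace ℝ (Fin n)) →ₗ[ℝ] (EuclideanSpace ℝ (Fin n))) < 0 := by
  have h : LinearMap.det (R.symm.toLinearEquiv : (EuclideanSpace ℝ (Fin n)) →ₗ[ℝ] (EuclideanSpace ℝ (Fin n))) =
      (LinearMap.det (R.toLinearEquiv : (EuclideanSpace ℝ (Fin n)) →ₗ[ℝ] (EuclideanSpace ℝ (Fin n))))⁻¹ :=
    LinearEquiv.det_coe_symm R.toLinearEquiv
  rw [h, hR]
  norm_num

/-- **A chart onto `ℝⁿ` whose disc preserves orientation**, with the same source as a given one: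
keep the chart if its disc `e.symm` preserves the orientations `(o₀, oM)`, otherwise compose it
with a reflection of `ℝⁿ` (Kervaire–Milnor, *Groups of homotopy spheres I* (1963), §2, p. 505:
the discs of a connected sum are chosen orientation preserving / reversing; Kosinski,
*Differential Manifolds* (1993), VI.1). [folklore] -/
theorem exists_chart_symm_isOrientationPreserving (hn : n ≠ 0)
    {e : OpenPartialHomeomorph M (EuclideanSpace ℝ (Fin n))}
    (he : e ∈ IsManifold.maximalAtlas (𝓡 n) ∞ M) (het : e.target = univ)
    (o₀ : Orientation ℝ (EuclideanSpace ℝ (Fin n)) (Fin (finrank ℝ (EuclideanSpace ℝ (Fin n)))))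
    (oM : SmoothOrientation (𝓡 n) M) :
    ∃ e' ∈ IsManifold.maximalAtlas (𝓡 n) ∞ M, e'.target = univ ∧ e'.source = e.source ∧
      IsOrientationPreserving (SmoothOrientation.modelSpace o₀) oM e'.symm := by
  have hi := isSmoothEmbedding_symm_of_target_eq_univ he het
  have ho : IsOpen (range e.symm) := by rw [range_symm_of_target_eq_univ het]; exact e.open_source
  rcases isOrientationPreserving_or_isOrientationReversing_disc hi ho o₀ oM with h | h
  · exact ⟨e, he, het, rfl, h⟩
  · obtain ⟨R, hR⟩ := exists_linearIsometryEquiv_det_eq_neg_one hn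
    refine ⟨e ≫ₕ R.toHomeomorph.toOpenPartialHomeomorph,
      trans_toOpenPartialHomeomorph_mem_maximalAtlas he R.toHomeomorph
        (R : (EuclideanSpace ℝ (Fin n)) →L[ℝ] (EuclideanSpace ℝ (Fin n))).contDiff.contMDiff
        (R.symm : (EuclideanSpace ℝ (Fin n)) →L[ℝ] (EuclideanSpace ℝ (Fin n))).contDiff.contMDiff,
      ?_, ?_, ?_⟩
    · rw [trans_target, Homeomorph.toOpenPartialHomeomorph_target, univ_inter, het, preimage_univ]
    · rw [trans_source, Homeomorph.toOpenPartialHomeomorph_source, preimage_univ, inter_univ]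
    · have hcoe : ⇑(e ≫ₕ R.toHomeomorph.toOpenPartialHomeomorph).symm = e.symm ∘ R.symm := by
        funext v; rfl
      rw [hcoe]
      -- `e.symm` reverses `(o₀, oM)`, i.e. preserves `(-o₀, oM)`; reflect
      have h' : IsOrientationPreserving (SmoothOrientation.modelSpace (-o₀)) oM e.symm := by
        rw [← SmoothOrientation.neg_modelSpace, ← isOrientationReversing_iff_neg]
        exact h
      have h2 := isOrientationReversing_disc_comp hi ho h' R.symm (det_symm_neg_of_det_eq_neg_one hR)
      rw [isOrientationReversing_iff, ← SmoothOrientation.neg_modelSpace,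
        isOrientationPreserving_neg_neg_iff] at h2
      exact h2

/-- **A chart onto `ℝⁿ` whose disc reverses orientation**, with the same source as a given one
(compose with a reflection if necessary; Kervaire–Milnor 1963, §2, p. 505). [folklore] -/
theorem exists_chart_symm_isOrientationReversing (hn : n ≠ 0)
    {e : OpenPartialHomeomorph M (EuclideanSpace ℝ (Fin n))}
    (he : e ∈ IsManifold.maximalAtlas (𝓡 n) ∞ M) (het : e.target = univ)
    (o₀ : Orientation ℝ (EuclideanSpace ℝ (Fin n)) (Fin (finrank ℝ (EuclideanSpace ℝ (Fin n)))))
    (oM : SmoothOrientation (𝓡 n) M) :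
    ∃ e' ∈ IsManifold.maximalAtlas (𝓡 n) ∞ M, e'.target = univ ∧ e'.source = e.source ∧
      IsOrientationReversing (SmoothOrientation.modelSpace o₀) oM e'.symm := by
  obtain ⟨e', he', het', hes', h⟩ := exists_chart_symm_isOrientationPreserving hn he het o₀ (-oM)
  exact ⟨e', he', het', hes', h⟩

/-- A point of the model space other than the origin (`n ≠ 0`). [folklore] -/
theorem exists_ne_zero_euclidean (hn : n ≠ 0) : ∃ v : EuclideanSpace ℝ (Fin n), v ≠ 0 := by
  haveI : Nontrivial (EuclideanSpace ℝ (Fin n)) :=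
    Module.nontrivial_of_finrank_pos (R := ℝ) (by rw [finrank_euclideanSpace_fin]; omega)
  exact exists_ne 0

/-- **Two charts onto `ℝⁿ` with disjoint sources** in a nonempty `n`-manifold, `n ≠ 0`: the
coordinate balls `B(±c, 1)`, `‖c‖ = 3`, of one chart onto `ℝⁿ`, re-parametrised by `ℝⁿ ≅ B`
(`Literature.Topology.FourManifolds.exists_chart_ball`). Used to place two disjoint discs in the middle summand of
`(M₁ # M₂) # M₃` (Kosinski, *Differential Manifolds* (1993), VI.1: discs with disjoint images).
[folklore] -/
theorem exists_charts_disjoint_source (hn : n ≠ 0) [Nonempty M] :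
    ∃ eb ∈ IsManifold.maximalAtlas (𝓡 n) ∞ M, ∃ ec ∈ IsManifold.maximalAtlas (𝓡 n) ∞ M,
      eb.target = univ ∧ ec.target = univ ∧ Disjoint eb.source ec.source := by
  obtain ⟨e, he, -, het, -⟩ :=
    exists_mem_maximalAtlas_target_eq_univ (E := EuclideanSpace ℝ (Fin n)) (M := M) (Classical.arbitrary M)
  obtain ⟨v, hv⟩ := exists_ne_zero_euclidean hn
  set c : EuclideanSpace ℝ (Fin n) := (3 / ‖v‖) • v with hc
  have hnc : ‖c‖ = 3 := by
    rw [hc, norm_smul, Real.norm_of_nonneg (by positivity), div_mul_cancel₀ _ (norm_ne_zero_iff.2 hv)]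
  have hdisj : Disjoint (ball c 1) (ball (-c) 1) := by
    apply ball_disjoint_ball
    rw [dist_eq_norm, sub_neg_eq_add, ← two_smul ℝ c, norm_smul, hnc, Real.norm_eq_abs]
    norm_num
  obtain ⟨eb, heb, hebt, hebs, -⟩ := exists_chart_ball he het c one_pos
  obtain ⟨ec, hec, hect, hecs, -⟩ := exists_chart_ball he het (-c) one_pos
  refine ⟨eb, heb, ec, hec, hebt, hect, ?_⟩
  rw [hebs, hecs]
  exact disjoint_image_symm_ball het hdisj

end Charts

/-! ### Kervaire–Milnor's relation at the level of points -/

section Witness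

variable {n : ℕ} {M N : Type*}

/-- Kervaire–Milnor's identification `i (t • u) ∼ j ((1 - t) • u)` is symmetric in the two discs
up to `t ↦ 1 - t` (point-level form of `Literature.Topology.FourManifolds.connectedSumRel_swap`; Kervaire–Milnor 1963, §2).
[folklore] -/
theorem connectedSum_witness_swap {i : EuclideanSpace ℝ (Fin n) → M} {j : EuclideanSpace ℝ (Fin n) → N}
    {x : M} {y : N} :
    (∃ (u : EuclideanSpace ℝ (Fin n)) (t : ℝ),
        ‖u‖ = 1 ∧ t ∈ Ioo (0 : ℝ) 1 ∧ x = i (t • u) ∧ y = j ((1 - t) • u)) ↔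
      ∃ (u : EuclideanSpace ℝ (Fin n)) (t : ℝ),
        ‖u‖ = 1 ∧ t ∈ Ioo (0 : ℝ) 1 ∧ y = j (t • u) ∧ x = i ((1 - t) • u) := by
  constructor
  · rintro ⟨u, t, hu, ht, hx, hy⟩
    refine ⟨u, 1 - t, hu, ⟨by linarith [ht.2], by linarith [ht.1]⟩, hy, ?_⟩
    rwa [sub_sub_cancel]
  · rintro ⟨u, t, hu, ht, hy, hx⟩
    refine ⟨u, 1 - t, hu, ⟨by linarith [ht.2], by linarith [ht.1]⟩, hx, ?_⟩
    rwa [sub_sub_cancel]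

end Witness


/-! ### Uniqueness of open gluings of THREE pieces, with the comparison equations -/

section GlueMap₃

variable {A B C P P' : Type*} {jA : A → P} {jB : B → P} {jC : C → P}
  {jA' : A → P'} {jB' : B → P'} {jC' : C → P'}

/-- The comparison map between two spaces covered by three injections, set-theoretic part: if
`P = jA(A) ∪ jB(B) ∪ jC(C)` and `jA', jB', jC'` respect all pairwise identifications of `P`, then
`jA a ↦ jA' a`, `jB b ↦ jB' b`, `jC c ↦ jC' c` is a well defined map `P → P'` (Kosinski,
*Differential Manifolds* (1993), VI.1, proof of (1.1), map `G`, for two gluing steps at once).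
[folklore] -/
theorem exists_map_apply_eq₃ (hU : range jA ∪ range jB ∪ range jC = univ)
    (hinjA : Injective jA) (hinjB : Injective jB) (hinjC : Injective jC)
    (hAB : ∀ a b, jA a = jB b → jA' a = jB' b) (hBC : ∀ b c, jB b = jC c → jB' b = jC' c)
    (hAC : ∀ a c, jA a = jC c → jA' a = jC' c) :
    ∃ G : P → P', (∀ a, G (jA a) = jA' a) ∧ (∀ b, G (jB b) = jB' b) ∧ ∀ c, G (jC c) = jC' c := by
  classical
  have hmem : ∀ p : P, p ∉ range jA → p ∉ range jB → p ∈ range jC := fun p h1 h2 => by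
    have := eq_univ_iff_forall.1 hU p
    rcases this with (h | h) | h
    · exact absurd h h1
    · exact absurd h h2
    · exact h
  refine ⟨fun p => if h : p ∈ range jA then jA' (Classical.choose h)
    else if h' : p ∈ range jB then jB' (Classical.choose h')
    else jC' (Classical.choose (hmem p h h')), fun a => ?_, fun b => ?_, fun c => ?_⟩
  · dsimp only
    rw [dif_pos (mem_range_self a)]
    exact congrArg jA' (hinjA (Classical.choose_spec (mem_range_self (f := jA) a)))
  · dsimp only
    by_cases h : jB b ∈ range jA
    · rw [dif_pos h]
      exact hAB _ _ (Classical.choose_spec h)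
    · rw [dif_neg h, dif_pos (mem_range_self b)]
      exact congrArg jB' (hinjB (Classical.choose_spec (mem_range_self (f := jB) b)))
  · dsimp only
    by_cases h : jC c ∈ range jA
    · rw [dif_pos h]
      exact hAC _ _ (Classical.choose_spec h)
    · rw [dif_neg h]
      by_cases h' : jC c ∈ range jB
      · rw [dif_pos h']
        exact hBC _ _ (Classical.choose_spec h')
      · rw [dif_neg h']
        exact congrArg jC' (hinjC (Classical.choose_spec (hmem (jC c) h h')))

end GlueMap₃

section GluingUnique₃

variable {EA HA EB HB EC HC EP HP HP' : Type*}
  [NormedAddCommGroup EA] [NormedSpace ℝ EA] [TopologicalSpace HA] {IA : ModelWithCorners ℝ EA HA}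
  [NormedAddCommGroup EB] [NormedSpace ℝ EB] [TopologicalSpace HB] {IB : ModelWithCorners ℝ EB HB}
  [NormedAddCommGroup EC] [NormedSpace ℝ EC] [TopologicalSpace HC] {IC : ModelWithCorners ℝ EC HC}
  [NormedAddCommGroup EP] [NormedSpace ℝ EP] [TopologicalSpace HP] {IP : ModelWithCorners ℝ EP HP}
  [TopologicalSpace HP'] {IP' : ModelWithCorners ℝ EP HP'}
  {A B C P P' : Type*} [TopologicalSpace A] [ChartedSpace HA A] [TopologicalSpace B]
  [ChartedSpace HB B] [TopologicalSpace C] [ChartedSpace HC C]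
  [TopologicalSpace P] [ChartedSpace HP P] [TopologicalSpace P'] [ChartedSpace HP' P']
  {jA : A → P} {jB : B → P} {jC : C → P} {jA' : A → P'} {jB' : B → P'} {jC' : C → P'}

/-- Smoothness of the three-piece comparison map (locally `jA' ∘ jA⁻¹`, `jB' ∘ jB⁻¹` or
`jC' ∘ jC⁻¹`, `contMDiffAt_of_comp_isImmersionAt`). [cite: Kosinski1993, Ch. VI §1, proof of Thm (1.1)] -/
theorem contMDiff_of_comp_eq₃ [IsManifold IP' ∞ P']
    (hA : Manifold.IsSmoothEmbedding IA IP ∞ jA) (hAo : IsOpen (range jA))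
    (hB : Manifold.IsSmoothEmbedding IB IP ∞ jB) (hBo : IsOpen (range jB))
    (hC : Manifold.IsSmoothEmbedding IC IP ∞ jC) (hCo : IsOpen (range jC))
    (hU : range jA ∪ range jB ∪ range jC = univ) (hA' : ContMDiff IA IP' ∞ jA')
    (hB' : ContMDiff IB IP' ∞ jB') (hC' : ContMDiff IC IP' ∞ jC')
    {G : P → P'} (hGA : ∀ a, G (jA a) = jA' a) (hGB : ∀ b, G (jB b) = jB' b)
    (hGC : ∀ c, G (jC c) = jC' c) : ContMDiff IP IP' ∞ G := by
  intro p
  rcases (eq_univ_iff_forall.1 hU p) with (⟨a, rfl⟩ | ⟨b, rfl⟩) | ⟨c, rfl⟩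
  · exact contMDiffAt_of_comp_isImmersionAt (hA.isImmersion.isImmersionAt a)
      (Topology.IsOpenEmbedding.isOpenMap ⟨hA.isEmbedding, hAo⟩) (hA' a) hGA
  · exact contMDiffAt_of_comp_isImmersionAt (hB.isImmersion.isImmersionAt b)
      (Topology.IsOpenEmbedding.isOpenMap ⟨hB.isEmbedding, hBo⟩) (hB' b) hGB
  · exact contMDiffAt_of_comp_isImmersionAt (hC.isImmersion.isImmersionAt c)
      (Topology.IsOpenEmbedding.isOpenMap ⟨hC.isEmbedding, hCo⟩) (hC' c) hGC

/-- **Uniqueness of open gluings of three pieces, with the comparison equations.** If `P` and `P'`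
are both covered by open smooth embeddings of `A`, `B`, `C` with the same pairwise
identifications, they are diffeomorphic by a diffeomorphism intertwining the embeddings (two
gluing steps of Kosinski, *Differential Manifolds* (1993), VI.(1.1), compared at once — used for
the re-bracketing `(M₁ # M₂) # M₃ = M₁ # (M₂ # M₃)` of Kervaire–Milnor (1963), Lemma 2.1
"associative"). [cite: Kosinski1993, Ch. VI §1, proof of Thm (1.1)] -/
theorem exists_diffeomorph_comp_eq₃ [IsManifold IP ∞ P] [IsManifold IP' ∞ P']
    (hA : Manifold.IsSmoothEmbedding IA IP ∞ jA) (hAo : IsOpen (range jA))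
    (hB : Manifold.IsSmoothEmbedding IB IP ∞ jB) (hBo : IsOpen (range jB))
    (hC : Manifold.IsSmoothEmbedding IC IP ∞ jC) (hCo : IsOpen (range jC))
    (hU : range jA ∪ range jB ∪ range jC = univ)
    (hA' : Manifold.IsSmoothEmbedding IA IP' ∞ jA') (hAo' : IsOpen (range jA'))
    (hB' : Manifold.IsSmoothEmbedding IB IP' ∞ jB') (hBo' : IsOpen (range jB'))
    (hC' : Manifold.IsSmoothEmbedding IC IP' ∞ jC') (hCo' : IsOpen (range jC'))
    (hU' : range jA' ∪ range jB' ∪ range jC' = univ)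
    (hAB : ∀ a b, jA a = jB b ↔ jA' a = jB' b) (hBC : ∀ b c, jB b = jC c ↔ jB' b = jC' c)
    (hAC : ∀ a c, jA a = jC c ↔ jA' a = jC' c) :
    ∃ Ψ : P ≃ₘ⟮IP, IP'⟯ P', (∀ a, Ψ (jA a) = jA' a) ∧ (∀ b, Ψ (jB b) = jB' b) ∧
      ∀ c, Ψ (jC c) = jC' c := by
  obtain ⟨G, hGA, hGB, hGC⟩ := exists_map_apply_eq₃ hU hA.isEmbedding.injective
    hB.isEmbedding.injective hC.isEmbedding.injective (fun a b => (hAB a b).1)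
    (fun b c => (hBC b c).1) (fun a c => (hAC a c).1)
  obtain ⟨G', hGA', hGB', hGC'⟩ := exists_map_apply_eq₃ hU' hA'.isEmbedding.injective
    hB'.isEmbedding.injective hC'.isEmbedding.injective (fun a b => (hAB a b).2)
    (fun b c => (hBC b c).2) (fun a c => (hAC a c).2)
  refine ⟨{ toFun := G
            invFun := G'
            left_inv := fun p => ?_
            right_inv := fun p => ?_
            contMDiff_toFun := contMDiff_of_comp_eq₃ hA hAo hB hBo hC hCo hU hA'.contMDiff
              hB'.contMDiff hC'.contMDiff hGA hGB hGC
            contMDiff_invFun := contMDiff_of_comp_eq₃ hA' hAo' hB' hBo' hC' hCo' hU'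
              hA.contMDiff hB.contMDiff hC.contMDiff hGA' hGB' hGC' }, hGA, hGB, hGC⟩
  · rcases eq_univ_iff_forall.1 hU p with (⟨a, rfl⟩ | ⟨b, rfl⟩) | ⟨c, rfl⟩
    · show G' (G (jA a)) = jA a
      rw [hGA, hGA']
    · show G' (G (jB b)) = jB b
      rw [hGB, hGB']
    · show G' (G (jC c)) = jC c
      rw [hGC, hGC']
  · rcases eq_univ_iff_forall.1 hU' p with (⟨a, rfl⟩ | ⟨b, rfl⟩) | ⟨c, rfl⟩
    · show G (G' (jA' a)) = jA' a
      rw [hGA', hGA]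
    · show G (G' (jB' b)) = jB' b
      rw [hGB', hGB]
    · show G (G' (jC' c)) = jC' c
      rw [hGC', hGC]

end GluingUnique₃


/-! ### Three open pieces of a nested connected sum -/

section ThreeCover

variable {n : ℕ}

variable {M₁ M₂ M₃ P T : Type*}
  [TopologicalSpace M₁] [T2Space M₁] [ChartedSpace (EuclideanSpace ℝ (Fin n)) M₁] [IsManifold (𝓡 n) ∞ M₁]
  [TopologicalSpace M₂] [T2Space M₂] [ChartedSpace (EuclideanSpace ℝ (Fin n)) M₂] [IsManifold (𝓡 n) ∞ M₂]
  [TopologicalSpace M₃] [T2Space M₃] [ChartedSpace (EuclideanSpace ℝ (Fin n)) M₃] [IsManifold (𝓡 n) ∞ M₃]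
  [TopologicalSpace P] [T2Space P] [ChartedSpace (EuclideanSpace ℝ (Fin n)) P] [IsManifold (𝓡 n) ∞ P]
  [TopologicalSpace T] [ChartedSpace (EuclideanSpace ℝ (Fin n)) T] [IsManifold (𝓡 n) ∞ T]

/-- **The three open pieces of `(M₁ # M₂) # M₃`.** Let `P` be glued from `M₁ ∖ {i₁ 0}` and
`M₂ ∖ {i₂ 0}` (open smooth embeddings `jA`, `jB`, Kervaire–Milnor's relation for the discs
`i₁`, `i₂`), and `T` from `P ∖ {k 0}` and `M₃ ∖ {i₃ 0}` (embeddings `jP`, `jC`, relation for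
`k`, `i₃`), where the disc `k` of `P` is `jB ∘ d` for a second disc `d` of `M₂` whose image is
disjoint from that of `i₂`. Then `T` is covered by open smooth embeddings of `M₁ ∖ {i₁ 0}`,
`M₂ ∖ {i₂ 0, d 0}` and `M₃ ∖ {i₃ 0}` which identify points exactly by Kervaire–Milnor's relations
for `(i₁, i₂)` and for `(d, i₃)` (the first and third pieces being disjoint), and which preserve
the orientations whenever `jA`, `jB`, `jP`, `jC` do (Kervaire–Milnor, *Groups of homotopy
spheres I* (1963), Lemma 2.1 "associative"; Kosinski, *Differential Manifolds* (1993), VI.1).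
[folklore] -/
theorem exists_threeCover (hn : n ≠ 0)
    {i₁ : EuclideanSpace ℝ (Fin n) → M₁} {i₂ d : EuclideanSpace ℝ (Fin n) → M₂} {i₃ : EuclideanSpace ℝ (Fin n) → M₃}
    {k : EuclideanSpace ℝ (Fin n) → P}
    (hi₁ : Manifold.IsSmoothEmbedding 𝓘(ℝ, EuclideanSpace ℝ (Fin n)) (𝓡 n) ∞ i₁)
    (hd : Manifold.IsSmoothEmbedding 𝓘(ℝ, EuclideanSpace ℝ (Fin n)) (𝓡 n) ∞ d) (hdisj : ∀ x y, i₂ x ≠ d y)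
    {jA : puncture i₁ → P} {jB : puncture i₂ → P}
    (hA : Manifold.IsSmoothEmbedding (𝓡 n) (𝓡 n) ∞ jA) (hAo : IsOpen (range jA))
    (hB : Manifold.IsSmoothEmbedding (𝓡 n) (𝓡 n) ∞ jB) (hBo : IsOpen (range jB))
    (hU : range jA ∪ range jB = univ) (hR : ∀ a b, jA a = jB b ↔ connectedSumRel i₁ i₂ a b)
    (hk : ∀ (y : EuclideanSpace ℝ (Fin n)) (hy : d y ∈ puncture i₂), k y = jB ⟨d y, hy⟩)
    {jP : puncture k → T} {jC : puncture i₃ → T}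
    (hP : Manifold.IsSmoothEmbedding (𝓡 n) (𝓡 n) ∞ jP) (hPo : IsOpen (range jP))
    (hC : Manifold.IsSmoothEmbedding (𝓡 n) (𝓡 n) ∞ jC) (hCo : IsOpen (range jC))
    (hU' : range jP ∪ range jC = univ) (hR' : ∀ p c, jP p = jC c ↔ connectedSumRel k i₃ p c)
    {B₂ : TopologicalSpace.Opens M₂} (hB₂ : ∀ b, b ∈ B₂ ↔ b ≠ i₂ 0 ∧ b ≠ d 0)
    {o₁ : SmoothOrientation (𝓡 n) M₁} {o₂ : SmoothOrientation (𝓡 n) M₂}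
    {o₃ : SmoothOrientation (𝓡 n) M₃} {oP : SmoothOrientation (𝓡 n) P}
    {oT : SmoothOrientation (𝓡 n) T}
    (hjA : IsOrientationPreserving (o₁.restrict (puncture i₁)) oP jA)
    (hjB : IsOrientationPreserving (o₂.restrict (puncture i₂)) oP jB)
    (hjP : IsOrientationPreserving (oP.restrict (puncture k)) oT jP)
    (hjC : IsOrientationPreserving (o₃.restrict (puncture i₃)) oT jC) :
    ∃ (α : puncture i₁ → T) (β : B₂ → T) (γ : puncture i₃ → T),
      (Manifold.IsSmoothEmbedding (𝓡 n) (𝓡 n) ∞ α ∧ IsOpen (range α)) ∧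
      (Manifold.IsSmoothEmbedding (𝓡 n) (𝓡 n) ∞ β ∧ IsOpen (range β)) ∧
      (Manifold.IsSmoothEmbedding (𝓡 n) (𝓡 n) ∞ γ ∧ IsOpen (range γ)) ∧
      range α ∪ range β ∪ range γ = univ ∧
      (∀ a b, α a = β b ↔ ∃ (u : EuclideanSpace ℝ (Fin n)) (t : ℝ), ‖u‖ = 1 ∧ t ∈ Ioo (0 : ℝ) 1 ∧
        (a : M₁) = i₁ (t • u) ∧ (b : M₂) = i₂ ((1 - t) • u)) ∧
      (∀ b c, β b = γ c ↔ ∃ (u : EuclideanSpace ℝ (Fin n)) (t : ℝ), ‖u‖ = 1 ∧ t ∈ Ioo (0 : ℝ) 1 ∧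
        (b : M₂) = d (t • u) ∧ (c : M₃) = i₃ ((1 - t) • u)) ∧
      (∀ a c, α a ≠ γ c) ∧
      IsOrientationPreserving (o₁.restrict (puncture i₁)) oT α ∧
      IsOrientationPreserving (o₂.restrict B₂) oT β ∧
      IsOrientationPreserving (o₃.restrict (puncture i₃)) oT γ := by
  -- membership bookkeeping
  have hdmem : ∀ y, d y ∈ puncture i₂ := fun y => mem_puncture.2 (hdisj 0 y).symm
  have hk0 : k 0 = jB ⟨d 0, hdmem 0⟩ := hk 0 _
  have hAk : ∀ a, jA a ∈ puncture k := fun a => by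
    rw [mem_puncture, hk0]
    intro h
    obtain ⟨u, t, -, -, -, hb⟩ := (hR a _).1 h
    exact hdisj _ _ hb.symm
  have hBmem : ∀ b : B₂, (b : M₂) ∈ puncture i₂ := fun b => mem_puncture.2 ((hB₂ b).1 b.2).1
  have hBk : ∀ b : B₂, jB ⟨b, hBmem b⟩ ∈ puncture k := fun b => by
    rw [mem_puncture, hk0]
    intro h
    exact ((hB₂ b).1 b.2).2 (congrArg Subtype.val (hB.isEmbedding.injective h))
  -- the three maps (`γ = jC`)
  set α : puncture i₁ → T := fun a => jP ⟨jA a, hAk a⟩ with hα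
  set φ₁ : B₂ → P := fun b => jB ⟨b, hBmem b⟩ with hφ₁
  set β : B₂ → T := fun b => jP ⟨φ₁ b, hBk b⟩ with hβ
  -- nonemptiness of the pieces (`n ≠ 0`)
  obtain ⟨v, hv⟩ := exists_ne_zero_euclidean hn
  haveI : Nonempty (puncture i₁) := ⟨⟨i₁ v, fun h => hv (hi₁.isEmbedding.injective h)⟩⟩
  haveI : Nonempty B₂ :=
    ⟨⟨d v, (hB₂ _).2 ⟨(hdisj 0 v).symm, fun h => hv (hd.isEmbedding.injective h)⟩⟩⟩
  -- embeddings with open ranges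
  have hαe := isSmoothEmbedding_comp_codRestrict hA hAo hAk hP hPo (φ := α) fun a => rfl
  have hval : Manifold.IsSmoothEmbedding (𝓡 n) (𝓡 n) ∞ (Subtype.val : B₂ → M₂) :=
    Manifold.IsSmoothEmbedding.of_opens B₂
  have hvalo : IsOpen (range (Subtype.val : B₂ → M₂)) := by
    rw [Subtype.range_coe]; exact B₂.isOpen
  have hφ₁e := isSmoothEmbedding_comp_codRestrict hval hvalo hBmem hB hBo (φ := φ₁) fun b => rfl
  have hβe := isSmoothEmbedding_comp_codRestrict hφ₁e.1 hφ₁e.2 hBk hP hPo (φ := β) fun b => rfl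
  -- orientations
  have hαo : IsOrientationPreserving (o₁.restrict (puncture i₁)) oT α :=
    isOrientationPreserving_comp_codRestrict hA hAo hAk hP hPo (fun a => rfl) hjA hjP
  have hφ₁o : IsOrientationPreserving (o₂.restrict B₂) oP φ₁ :=
    isOrientationPreserving_comp_codRestrict hval hvalo hBmem hB hBo (fun b => rfl)
      (isOrientationPreserving_subtype_val o₂ B₂) hjB
  have hβo : IsOrientationPreserving (o₂.restrict B₂) oT β :=
    isOrientationPreserving_comp_codRestrict hφ₁e.1 hφ₁e.2 hBk hP hPo (fun b => rfl) hφ₁o hjP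
  refine ⟨α, β, jC, hαe, hβe, ⟨hC, hCo⟩, ?_, ?_, ?_, ?_, hαo, hβo, hjC⟩
  · -- the three ranges cover `T`
    refine eq_univ_iff_forall.2 fun p => ?_
    rcases eq_univ_iff_forall.1 hU' p with ⟨q, rfl⟩ | ⟨c, rfl⟩
    · rcases eq_univ_iff_forall.1 hU (q : P) with ⟨a, ha⟩ | ⟨b, hb⟩
      · exact Or.inl (Or.inl ⟨a, congrArg jP (Subtype.ext ha)⟩)
      · have hb2 : (b : M₂) ∈ B₂ := by
          refine (hB₂ _).2 ⟨mem_puncture.1 b.2, fun h => q.2 ?_⟩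
          rw [← hb, hk0]
          exact congrArg jB (Subtype.ext h)
        exact Or.inl (Or.inr ⟨⟨b, hb2⟩, congrArg jP (Subtype.ext hb)⟩)
    · exact Or.inr ⟨c, rfl⟩
  · -- `α a = β b ↔ (a, b)` related for `(i₁, i₂)`
    intro a b
    constructor
    · intro h
      exact (hR a _).1 (congrArg Subtype.val (hP.isEmbedding.injective h))
    · intro h
      exact congrArg jP (Subtype.ext ((hR a ⟨b, hBmem b⟩).2 h))
  · -- `β b = γ c ↔ (b, c)` related for `(d, i₃)`
    intro b c
    constructor
    · intro h
      obtain ⟨u, t, hu, ht, hq, hc⟩ := (hR' _ c).1 h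
      change φ₁ b = k (t • u) at hq
      rw [hk _ (hdmem _)] at hq
      exact ⟨u, t, hu, ht, congrArg Subtype.val (hB.isEmbedding.injective hq), hc⟩
    · rintro ⟨u, t, hu, ht, hb, hc⟩
      refine (hR' _ c).2 ⟨u, t, hu, ht, ?_, hc⟩
      change φ₁ b = k (t • u)
      rw [hk _ (hdmem _)]
      exact congrArg jB (Subtype.ext hb)
  · -- the first and third pieces are disjoint
    intro a c h
    obtain ⟨u, t, -, -, hq, -⟩ := (hR' _ c).1 h
    change jA a = k (t • u) at hq
    rw [hk _ (hdmem _)] at hq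
    obtain ⟨u', t', -, -, -, hb⟩ := (hR a _).1 hq
    exact hdisj _ _ hb.symm

end ThreeCover


/-! ### Comparison of two three-piece covers -/

section ThreeUnique

variable {n : ℕ}

variable {A B C T T' : Type*}
  [TopologicalSpace A] [ChartedSpace (EuclideanSpace ℝ (Fin n)) A] [IsManifold (𝓡 n) ∞ A]
  [TopologicalSpace B] [ChartedSpace (EuclideanSpace ℝ (Fin n)) B] [IsManifold (𝓡 n) ∞ B]
  [TopologicalSpace C] [ChartedSpace (EuclideanSpace ℝ (Fin n)) C] [IsManifold (𝓡 n) ∞ C]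
  [TopologicalSpace T] [ChartedSpace (EuclideanSpace ℝ (Fin n)) T] [IsManifold (𝓡 n) ∞ T]
  [TopologicalSpace T'] [ChartedSpace (EuclideanSpace ℝ (Fin n)) T'] [IsManifold (𝓡 n) ∞ T']

/-- **Two oriented manifolds covered by three open smooth embeddings of the same pieces with the
same identifications are diffeomorphic by an orientation-preserving diffeomorphism**, provided
all six embeddings preserve orientation: the comparison diffeomorphism of
`Literature.Topology.FourManifolds.exists_diffeomorph_comp_eq₃` intertwines the embeddings, hence preserves orientation at
every point (cancellation rule `Literature.Topology.FourManifolds.orientationAt_of_comp_left`). This is the form in which the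
re-bracketing `(M₁ # M₂) # M₃ ≅ M₁ # (M₂ # M₃)` is proved (Kervaire–Milnor 1963, Lemma 2.1
"associative"; Kosinski, *Differential Manifolds* (1993), VI.1). [folklore] -/
theorem exists_diffeomorph_of_threeCovers
    {α : A → T} {β : B → T} {γ : C → T} {α' : A → T'} {β' : B → T'} {γ' : C → T'}
    (hα : Manifold.IsSmoothEmbedding (𝓡 n) (𝓡 n) ∞ α ∧ IsOpen (range α))
    (hβ : Manifold.IsSmoothEmbedding (𝓡 n) (𝓡 n) ∞ β ∧ IsOpen (range β))
    (hγ : Manifold.IsSmoothEmbedding (𝓡 n) (𝓡 n) ∞ γ ∧ IsOpen (range γ))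
    (hU : range α ∪ range β ∪ range γ = univ)
    (hα' : Manifold.IsSmoothEmbedding (𝓡 n) (𝓡 n) ∞ α' ∧ IsOpen (range α'))
    (hβ' : Manifold.IsSmoothEmbedding (𝓡 n) (𝓡 n) ∞ β' ∧ IsOpen (range β'))
    (hγ' : Manifold.IsSmoothEmbedding (𝓡 n) (𝓡 n) ∞ γ' ∧ IsOpen (range γ'))
    (hU' : range α' ∪ range β' ∪ range γ' = univ)
    (hAB : ∀ a b, α a = β b ↔ α' a = β' b) (hBC : ∀ b c, β b = γ c ↔ β' b = γ' c)
    (hAC : ∀ a c, α a ≠ γ c) (hAC' : ∀ a c, α' a ≠ γ' c)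
    {oA : SmoothOrientation (𝓡 n) A} {oB : SmoothOrientation (𝓡 n) B}
    {oC : SmoothOrientation (𝓡 n) C} {oT : SmoothOrientation (𝓡 n) T}
    {oT' : SmoothOrientation (𝓡 n) T'}
    (hαo : IsOrientationPreserving oA oT α) (hβo : IsOrientationPreserving oB oT β)
    (hγo : IsOrientationPreserving oC oT γ) (hα'o : IsOrientationPreserving oA oT' α')
    (hβ'o : IsOrientationPreserving oB oT' β') (hγ'o : IsOrientationPreserving oC oT' γ') :
    ∃ Ψ : T ≃ₘ⟮𝓡 n, 𝓡 n⟯ T', Ψ.IsOrientationPreserving oT oT' := by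
  obtain ⟨Ψ, hΨA, hΨB, hΨC⟩ := exists_diffeomorph_comp_eq₃ hα.1 hα.2 hβ.1 hβ.2 hγ.1 hγ.2 hU
    hα'.1 hα'.2 hβ'.1 hβ'.2 hγ'.1 hγ'.2 hU' hAB hBC
    (fun a c => iff_of_false (hAC a c) (hAC' a c))
  refine ⟨Ψ, fun p => ?_⟩
  have hΨd : ∀ q, MDifferentiableAt (𝓡 n) (𝓡 n) Ψ q := fun q => Ψ.mdifferentiable (by simp) q
  rcases eq_univ_iff_forall.1 hU p with (⟨a, rfl⟩ | ⟨b, rfl⟩) | ⟨c, rfl⟩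
  · have hcomp : (Ψ : T → T') ∘ α = α' := funext hΨA
    have h1 := hα'o a
    rw [← hcomp] at h1
    exact orientationAt_of_comp_left (oM := oA) (oN := oT) (oP := oT') (f := α) (g := Ψ) (x := a)
      ((hα.1.contMDiff a).mdifferentiableAt (by simp)) (hΨd _)
      (det_mfderiv_ne_zero_of_isSmoothEmbedding hα.1 hα.2 a) (Ψ.det_mfderiv_ne_zero (by simp) _)
      (hαo a) h1
  · have hcomp : (Ψ : T → T') ∘ β = β' := funext hΨB
    have h1 := hβ'o b
    rw [← hcomp] at h1
    exact orientationAt_of_comp_left (oM := oB) (oN := oT) (oP := oT') (f := β) (g := Ψ) (x := b)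
      ((hβ.1.contMDiff b).mdifferentiableAt (by simp)) (hΨd _)
      (det_mfderiv_ne_zero_of_isSmoothEmbedding hβ.1 hβ.2 b) (Ψ.det_mfderiv_ne_zero (by simp) _)
      (hβo b) h1
  · have hcomp : (Ψ : T → T') ∘ γ = γ' := funext hΨC
    have h1 := hγ'o c
    rw [← hcomp] at h1
    exact orientationAt_of_comp_left (oM := oC) (oN := oT) (oP := oT') (f := γ) (g := Ψ) (x := c)
      ((hγ.1.contMDiff c).mdifferentiableAt (by simp)) (hΨd _)
      (det_mfderiv_ne_zero_of_isSmoothEmbedding hγ.1 hγ.2 c) (Ψ.det_mfderiv_ne_zero (by simp) _)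
      (hγo c) h1

end ThreeUnique

/-! ### The nested sum `(M # N) # K` with standard discs, and its three pieces -/

section Nested

universe u

variable {n : ℕ}

variable {M N K : Type u}
  [TopologicalSpace M] [T2Space M] [ChartedSpace (EuclideanSpace ℝ (Fin n)) M] [IsManifold (𝓡 n) ∞ M]
  [TopologicalSpace N] [T2Space N] [ChartedSpace (EuclideanSpace ℝ (Fin n)) N] [IsManifold (𝓡 n) ∞ N]
  [TopologicalSpace K] [T2Space K] [ChartedSpace (EuclideanSpace ℝ (Fin n)) K] [IsManifold (𝓡 n) ∞ K]

/-- **The nested connected sum `(M # N) # K` on standard discs.** Let `D` be connected sum data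
for `M`, `N` (charts onto `ℝⁿ`, discs `i₁ = D.i₁` preserving and `i₂ = D.i₂` reversing the
orientations for the constant orientation `o₀`), let `ed` be a further chart of `N` onto `ℝⁿ`
whose disc `d = ed.symm` preserves orientation and has image disjoint from that of `i₂`, and let
`e₃` be a chart of `K` onto `ℝⁿ` with orientation-reversing disc. Then there is an oriented
smooth `n`-manifold `(T, oT)` which is an oriented connected sum of Kosinski's model
`(D.Glued, D.orientation)` of `M # N` and `(K, oK)` — namely the model glued along the disc
`jB ∘ d` of `M # N` and the disc `e₃.symm` of `K` — together with three open smooth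
orientation-preserving embeddings of `M ∖ {i₁ 0}`, `N ∖ {i₂ 0, d 0}`, `K ∖ {e₃.symm 0}` covering
`T`, identifying points exactly by Kervaire–Milnor's relations for `(i₁, i₂)` and `(d, e₃.symm)`,
the first and third being disjoint (`Literature.Topology.FourManifolds.exists_threeCover`). Kervaire–Milnor 1963, Lemma 2.1;
Kosinski (1993), VI.1. [folklore] -/
theorem exists_nested_glued (hn : n ≠ 0) (D : ConnectedSumData n M N)
    {o₀ : Orientation ℝ (EuclideanSpace ℝ (Fin n)) (Fin (finrank ℝ (EuclideanSpace ℝ (Fin n))))}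
    {oM : SmoothOrientation (𝓡 n) M} {oN : SmoothOrientation (𝓡 n) N}
    {oK : SmoothOrientation (𝓡 n) K}
    (h₁ : IsOrientationPreserving (SmoothOrientation.modelSpace o₀) oM D.i₁)
    (h₂ : IsOrientationReversing (SmoothOrientation.modelSpace o₀) oN D.i₂)
    {ed : OpenPartialHomeomorph N (EuclideanSpace ℝ (Fin n))} (hed : ed ∈ IsManifold.maximalAtlas (𝓡 n) ∞ N)
    (hedt : ed.target = univ)
    (hd : IsOrientationPreserving (SmoothOrientation.modelSpace o₀) oN ed.symm)
    (hdisj : ∀ x y, D.i₂ x ≠ ed.symm y)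
    {e₃ : OpenPartialHomeomorph K (EuclideanSpace ℝ (Fin n))} (he₃ : e₃ ∈ IsManifold.maximalAtlas (𝓡 n) ∞ K)
    (he₃t : e₃.target = univ)
    (h₃ : IsOrientationReversing (SmoothOrientation.modelSpace o₀) oK e₃.symm)
    {B₂ : TopologicalSpace.Opens N} (hB₂ : ∀ b, b ∈ B₂ ↔ b ≠ D.i₂ 0 ∧ b ≠ ed.symm 0) :
    ∃ (T : Type u) (_ : TopologicalSpace T) (_ : T2Space T) (_ : ChartedSpace (EuclideanSpace ℝ (Fin n)) T)
      (_ : IsManifold (𝓡 n) ∞ T) (oT : SmoothOrientation (𝓡 n) T),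
      (haveI := D.t2Space_glued hn
       IsOrientedConnectedSum (D.orientation hn oM oN o₀ h₁ h₂) oK oT) ∧
      ∃ (α : puncture D.i₁ → T) (β : B₂ → T) (γ : puncture ⇑e₃.symm → T),
        (Manifold.IsSmoothEmbedding (𝓡 n) (𝓡 n) ∞ α ∧ IsOpen (range α)) ∧
        (Manifold.IsSmoothEmbedding (𝓡 n) (𝓡 n) ∞ β ∧ IsOpen (range β)) ∧
        (Manifold.IsSmoothEmbedding (𝓡 n) (𝓡 n) ∞ γ ∧ IsOpen (range γ)) ∧
        range α ∪ range β ∪ range γ = univ ∧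
        (∀ a b, α a = β b ↔ ∃ (u : EuclideanSpace ℝ (Fin n)) (t : ℝ), ‖u‖ = 1 ∧ t ∈ Ioo (0 : ℝ) 1 ∧
          (a : M) = D.i₁ (t • u) ∧ (b : N) = D.i₂ ((1 - t) • u)) ∧
        (∀ b c, β b = γ c ↔ ∃ (u : EuclideanSpace ℝ (Fin n)) (t : ℝ), ‖u‖ = 1 ∧ t ∈ Ioo (0 : ℝ) 1 ∧
          (b : N) = ed.symm (t • u) ∧ (c : K) = e₃.symm ((1 - t) • u)) ∧
        (∀ a c, α a ≠ γ c) ∧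
        IsOrientationPreserving (oM.restrict (puncture D.i₁)) oT α ∧
        IsOrientationPreserving (oN.restrict B₂) oT β ∧
        IsOrientationPreserving (oK.restrict (puncture ⇑e₃.symm)) oT γ := by
  haveI := D.t2Space_glued hn
  have hdmem : ∀ y, ed.symm y ∈ D.B := fun y => mem_puncture.2 (hdisj 0 y).symm
  -- the disc `k = jB ∘ d` of `M # N`
  set kf : EuclideanSpace ℝ (Fin n) → D.Glued hn := fun y => (D.glueData hn).inr ⟨ed.symm y, hdmem y⟩ with hkf
  have hdemb := isSmoothEmbedding_symm_of_target_eq_univ hed hedt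
  have hdo : IsOpen (range ed.symm) := by
    rw [range_symm_of_target_eq_univ hedt]; exact ed.open_source
  have hke := isSmoothEmbedding_comp_codRestrict hdemb hdo hdmem
    (D.glueData hn).isSmoothEmbedding_inr (D.glueData hn).isOpen_range_inr (φ := kf) fun y => rfl
  have hko : IsOrientationPreserving (SmoothOrientation.modelSpace o₀)
      (D.orientation hn oM oN o₀ h₁ h₂) kf :=
    isOrientationPreserving_comp_codRestrict hdemb hdo hdmem (D.glueData hn).isSmoothEmbedding_inr
      (D.glueData hn).isOpen_range_inr (fun y => rfl) hd (D.isOrientationPreserving_inr hn oM oN o₀ h₁ h₂)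
  -- a chart of `M # N` with inverse `k`, and the second-level data
  obtain ⟨Φ, hΦt, hΦsymm, -, hΦs⟩ := exists_chart_of_isSmoothEmbedding hke.1
  have hΦatlas : Φ ∈ IsManifold.maximalAtlas (𝓡 n) ∞ (D.Glued hn) :=
    Φ.mem_maximalAtlas_of_contMDiffOn hΦs (by
      rw [hΦsymm, hΦt]
      exact hke.1.contMDiff.contMDiffOn)
  obtain ⟨D', rfl, rfl⟩ : ∃ D' : ConnectedSumData n (D.Glued hn) K, D'.e₁ = Φ ∧ D'.e₂ = e₃ :=
    ⟨⟨Φ, e₃, hΦatlas, he₃, hΦt, he₃t⟩, rfl, rfl⟩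
  have hD'i₁ : D'.i₁ = kf := hΦsymm
  have h₁' : IsOrientationPreserving (SmoothOrientation.modelSpace o₀)
      (D.orientation hn oM oN o₀ h₁ h₂) D'.i₁ := by
    rw [hD'i₁]; exact hko
  have h₂' : IsOrientationReversing (SmoothOrientation.modelSpace o₀) oK D'.i₂ := h₃
  haveI := D'.t2Space_glued hn
  refine ⟨D'.Glued hn, inferInstance, inferInstance, inferInstance, inferInstance,
    D'.orientation hn _ oK o₀ h₁' h₂', D'.isOrientedConnectedSum_glued hn _ oK o₀ h₁' h₂', ?_⟩
  exact exists_threeCover hn D.isSmoothEmbedding_i₁ hdemb hdisj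
    (D.glueData hn).isSmoothEmbedding_inl (D.glueData hn).isOpen_range_inl
    (D.glueData hn).isSmoothEmbedding_inr (D.glueData hn).isOpen_range_inr
    (D.glueData hn).range_inl_union_range_inr
    (fun a b => (D.glueData hn).inl_eq_inr_iff.trans (D.connectedSumRel_iff_φ hn a b).symm)
    (k := D'.i₁) (fun y hy => by rw [hD'i₁])
    (D'.glueData hn).isSmoothEmbedding_inl (D'.glueData hn).isOpen_range_inl
    (D'.glueData hn).isSmoothEmbedding_inr (D'.glueData hn).isOpen_range_inr
    (D'.glueData hn).range_inl_union_range_inr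
    (fun p c => (D'.glueData hn).inl_eq_inr_iff.trans (D'.connectedSumRel_iff_φ hn p c).symm)
    hB₂ (D.isOrientationPreserving_inl hn oM oN o₀ h₁ h₂)
    (D.isOrientationPreserving_inr hn oM oN o₀ h₁ h₂)
    (D'.isOrientationPreserving_inl hn _ oK o₀ h₁' h₂')
    (D'.isOrientationPreserving_inr hn _ oK o₀ h₁' h₂')

end Nested


/-! ### Associativity of the oriented connected sum -/

section Assoc

universe u

/-- **Associativity of the oriented connected sum** — discharge of the named fact
`Literature.Topology.FourManifolds.isOrientedConnectedSum_assoc` (`HomotopySpheresGroup.lean`; Kervaire–Milnor, *Groups of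
homotopy spheres I*, Ann. of Math. 77 (1963), Lemma 2.1, p. 505: "The connected sum operation is
well defined, associative, and commutative up to orientation preserving diffeomorphism";
Kosinski, *Differential Manifolds* (1993), Ch. VI §1). Given oriented sums `P₁₂ = M₁ # M₂`,
`Q = P₁₂ # M₃`, `P₂₃ = M₂ # M₃`, `Q' = M₁ # P₂₃` of closed connected oriented `n`-manifolds:
for `n = 0` the hypotheses are contradictory (a connected `0`-manifold is a point, so `P₁₂` would
be empty). For `n ≠ 0` choose charts onto `ℝⁿ`: `e₁` of `M₁` (fixing the constant orientation
`o₀` by its disc), two charts `eb`, `ec` of `M₂` with DISJOINT sources and discs reversing resp.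
preserving orientation, and `e₃` of `M₃` with reversing disc. The standard models
`T = (M₁ # M₂) # M₃` (Kosinski's glued manifolds on the discs `e₁⁻¹, eb⁻¹`, then `jB ∘ ec⁻¹, e₃⁻¹`)
and `T' = (M₃ #' M₂) #' M₁` (the same construction for the constant orientation `-o₀` on the
discs `e₃⁻¹, ec⁻¹`, then `jB ∘ eb⁻¹, e₁⁻¹`; by the symmetry of oriented connected sums this is a
model of `M₁ # (M₂ # M₃)`) are both covered by open orientation-preserving embeddings of
`M₁ ∖ {pt}`, `M₂ ∖ {2 pts}`, `M₃ ∖ {pt}` with the same identifications (`Literature.Topology.FourManifolds.exists_nested_glued`),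
hence `T ≅ T'` preserving orientation (`Literature.Topology.FourManifolds.exists_diffeomorph_of_threeCovers`); and `Q ≅ T`,
`Q' ≅ T'` by the uniqueness of oriented connected sums
(`Literature.Topology.FourManifolds.exists_diffeomorph_isOrientationPreserving_of_isOrientedConnectedSum_euclidean`, the lemma
of Palais–Cerf) applied twice on each side, after transporting along `P₁₂ ≅ M₁ # M₂`,
`P₂₃ ≅ M₂ # M₃` (`Literature.IsOrientedConnectedSum.of_diffeomorph_left/right`).
[cite: KervaireMilnorAnnals1963, Lemma 2.1 (p. 505)] [cite: Kosinski1993, Ch. VI §1, Thm (1.1)] -/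
theorem isOrientedConnectedSum_assoc_holds : isOrientedConnectedSum_assoc.{u} := by
  intro n M₁ M₂ M₃ P₁₂ P₂₃ Q Q' _ _ _ _ _ _ _ _ _ _ _ _ _ _ _ _ _ _ _ _ _ _ _ _ _ _ _ _ _ _ _ _ _ _ _
    _ _ _ _ _ _ _ _ _ _ _ _ o₁ o₂ o₃ o₁₂ o₂₃ oQ oQ' h₁₂ hQ h₂₃ hQ'
  rcases eq_or_ne n 0 with hn | hn
  · -- dimension `0`: `M₁`, `M₂` are points and `P₁₂` would be empty
    exfalso
    obtain ⟨i₁, i₂, o₀, jA, jB, -, -, -, -, ⟨-, -, -, -, hU, -⟩, -, -⟩ := h₁₂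
    have hM : ∀ a : M₁, a = i₁ 0 := fun a => by
      have hclopen : IsClopen ({i₁ 0} : Set M₁) :=
        ⟨isClosed_singleton, isOpen_singleton_of_chartedSpace_zero hn (i₁ 0)⟩
      have h1 := hclopen.eq_univ (singleton_nonempty _)
      exact mem_singleton_iff.1 (h1.symm ▸ mem_univ a)
    have hN : ∀ b : M₂, b = i₂ 0 := fun b => by
      have hclopen : IsClopen ({i₂ 0} : Set M₂) :=
        ⟨isClosed_singleton, isOpen_singleton_of_chartedSpace_zero hn (i₂ 0)⟩
      have h1 := hclopen.eq_univ (singleton_nonempty _)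
      exact mem_singleton_iff.1 (h1.symm ▸ mem_univ b)
    haveI : IsEmpty ↥(puncture i₁) := ⟨fun a => a.2 (mem_singleton_iff.2 (hM a))⟩
    haveI : IsEmpty ↥(puncture i₂) := ⟨fun b => b.2 (mem_singleton_iff.2 (hN b))⟩
    have hP : IsEmpty P₁₂ := ⟨fun p => by
      rcases eq_univ_iff_forall.1 hU p with ⟨a, -⟩ | ⟨b, -⟩
      · exact isEmptyElim a
      · exact isEmptyElim b⟩
    exact hP.false (Classical.arbitrary P₁₂)
  -- charts onto `ℝⁿ`: `e₁` of `M₁` fixing `o₀`; `eb`, `ec` of `M₂` (disjoint); `e₃` of `M₃`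
  obtain ⟨e₁₀, he₁, -, he₁t, -⟩ :=
    exists_mem_maximalAtlas_target_eq_univ (E := EuclideanSpace ℝ (Fin n)) (M := M₁) (Classical.arbitrary M₁)
  obtain ⟨o₀, h₁⟩ := exists_isOrientationPreserving_disc
    (isSmoothEmbedding_symm_of_target_eq_univ he₁ he₁t)
    (by rw [range_symm_of_target_eq_univ he₁t]; exact e₁₀.open_source) o₁
  obtain ⟨eb₀, heb₀, ec₀, hec₀, heb₀t, hec₀t, hdisj₀⟩ := exists_charts_disjoint_source (M := M₂) hn
  obtain ⟨eb, heb, hebt, hebs, h₂b⟩ := exists_chart_symm_isOrientationReversing hn heb₀ heb₀t o₀ o₂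
  obtain ⟨ec, hec, hect, hecs, h₂c⟩ := exists_chart_symm_isOrientationPreserving hn hec₀ hec₀t o₀ o₂
  have hdisj : Disjoint eb.source ec.source := by rw [hebs, hecs]; exact hdisj₀
  have hbc : ∀ x y, eb.symm x ≠ ec.symm y := fun x y h =>
    Set.disjoint_iff.1 hdisj ⟨eb.map_target (by rw [hebt]; trivial),
      h ▸ ec.map_target (by rw [hect]; trivial)⟩
  have hcb : ∀ x y, ec.symm x ≠ eb.symm y := fun x y h => hbc y x h.symm
  obtain ⟨e₃₀, he₃₀, -, he₃₀t, -⟩ :=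
    exists_mem_maximalAtlas_target_eq_univ (E := EuclideanSpace ℝ (Fin n)) (M := M₃) (Classical.arbitrary M₃)
  obtain ⟨e₃, he₃, he₃t, -, h₃⟩ := exists_chart_symm_isOrientationReversing hn he₃₀ he₃₀t o₀ o₃
  -- the middle piece `M₂ ∖ {eb⁻¹ 0, ec⁻¹ 0}`
  set B₂ : TopologicalSpace.Opens M₂ := puncture ⇑eb.symm ⊓ puncture ⇑ec.symm with hB₂def
  have hB₂ : ∀ b, b ∈ B₂ ↔ b ≠ eb.symm 0 ∧ b ≠ ec.symm 0 := fun b => Iff.rfl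
  have hB₂' : ∀ b, b ∈ B₂ ↔ b ≠ ec.symm 0 ∧ b ≠ eb.symm 0 := fun b => (hB₂ b).trans and_comm
  -- `T = (M₁ # M₂) # M₃` on the discs `e₁⁻¹, eb⁻¹ ; jB ∘ ec⁻¹, e₃⁻¹`
  obtain ⟨D₁₂, rfl, rfl⟩ : ∃ D : ConnectedSumData n M₁ M₂, D.e₁ = e₁₀ ∧ D.e₂ = eb :=
    ⟨⟨e₁₀, eb, he₁, heb, he₁t, hebt⟩, rfl, rfl⟩
  obtain ⟨T, _, _, _, _, oT, hT, α, β, γ, hαe, hβe, hγe, hUT, hαβ, hβγ, hαγ, hαo, hβo, hγo⟩ :=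
    exists_nested_glued hn D₁₂ (oK := o₃) h₁ h₂b hec hect h₂c hbc he₃ he₃t h₃ hB₂
  -- `T' = (M₃ #' M₂) #' M₁` for the constant orientation `-o₀`, discs `e₃⁻¹, ec⁻¹ ; jB ∘ eb⁻¹, e₁⁻¹`
  have h₃' : IsOrientationPreserving (SmoothOrientation.modelSpace (-o₀)) o₃ e₃.symm := by
    rw [← SmoothOrientation.neg_modelSpace, ← isOrientationReversing_iff_neg]; exact h₃
  have h₂c' : IsOrientationReversing (SmoothOrientation.modelSpace (-o₀)) o₂ ec.symm := by
    rw [isOrientationReversing_iff, ← SmoothOrientation.neg_modelSpace,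
      isOrientationPreserving_neg_neg_iff]; exact h₂c
  have h₂b' : IsOrientationPreserving (SmoothOrientation.modelSpace (-o₀)) o₂ D₁₂.e₂.symm := by
    rw [← SmoothOrientation.neg_modelSpace, ← isOrientationReversing_iff_neg]; exact h₂b
  have h₁' : IsOrientationReversing (SmoothOrientation.modelSpace (-o₀)) o₁ D₁₂.e₁.symm := by
    rw [isOrientationReversing_iff, ← SmoothOrientation.neg_modelSpace,
      isOrientationPreserving_neg_neg_iff]; exact h₁
  obtain ⟨D₃₂, rfl, rfl⟩ : ∃ D : ConnectedSumData n M₃ M₂, D.e₁ = e₃ ∧ D.e₂ = ec :=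
    ⟨⟨e₃, ec, he₃, hec, he₃t, hect⟩, rfl, rfl⟩
  obtain ⟨T', _, _, _, _, oT', hT', α', β', γ', hα'e, hβ'e, hγ'e, hUT', hα'β', hβ'γ', hα'γ', hα'o,
      hβ'o, hγ'o⟩ :=
    exists_nested_glued hn D₃₂ (oK := o₁) h₃' h₂c' heb hebt h₂b' hcb he₁ he₁t h₁' hB₂'
  -- `T ≅ T'` preserving orientation: same three pieces, same identifications
  have hUT'' : range γ' ∪ range β' ∪ range α' = univ := by
    rw [← hUT']; ac_rfl
  obtain ⟨Ψ, hΨ⟩ := exists_diffeomorph_of_threeCovers hαe hβe hγe hUT hγ'e hβ'e hα'e hUT''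
    (fun a b => (hαβ a b).trans (connectedSum_witness_swap.trans ((hβ'γ' b a).symm.trans eq_comm)))
    (fun b c => (hβγ b c).trans (connectedSum_witness_swap.trans ((hα'β' c b).symm.trans eq_comm)))
    hαγ (fun a c h => hα'γ' c a h.symm) hαo hβo hγo hγ'o hβ'o hα'o
  -- `Q ≅ T`: uniqueness for `M₁ # M₂`, transport, uniqueness for `P₁₂ # M₃`
  haveI := D₁₂.t2Space_glued hn
  obtain ⟨φ₁₂, hφ₁₂⟩ := exists_diffeomorph_isOrientationPreserving_of_isOrientedConnectedSum_euclidean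
    h₁₂ (D₁₂.isOrientedConnectedSum_glued hn o₁ o₂ o₀ h₁ h₂b)
  have hT₂ : IsOrientedConnectedSum o₁₂ o₃ oT :=
    hT.of_diffeomorph_left φ₁₂.symm (Diffeomorph.IsOrientationPreserving.symm_holds hφ₁₂ (by simp))
  obtain ⟨ψ₁, hψ₁⟩ :=
    exists_diffeomorph_isOrientationPreserving_of_isOrientedConnectedSum_euclidean hQ hT₂
  -- `Q' ≅ T'`: symmetry, uniqueness for `M₂ # M₃`, transport, uniqueness for `M₁ # P₂₃`
  haveI := D₃₂.t2Space_glued hn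
  obtain ⟨φ₂₃, hφ₂₃⟩ := exists_diffeomorph_isOrientationPreserving_of_isOrientedConnectedSum_euclidean
    h₂₃ (D₃₂.isOrientedConnectedSum_glued hn o₃ o₂ (-o₀) h₃' h₂c').symm
  have hT'₂ : IsOrientedConnectedSum o₁ o₂₃ oT' :=
    hT'.symm.of_diffeomorph_right φ₂₃.symm (Diffeomorph.IsOrientationPreserving.symm_holds hφ₂₃ (by simp))
  obtain ⟨ψ₂, hψ₂⟩ :=
    exists_diffeomorph_isOrientationPreserving_of_isOrientedConnectedSum_euclidean hQ' hT'₂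
  exact ⟨ψ₁.trans (Ψ.trans ψ₂.symm), Diffeomorph.IsOrientationPreserving.trans_holds hψ₁
    (Diffeomorph.IsOrientationPreserving.trans_holds hΨ
      (Diffeomorph.IsOrientationPreserving.symm_holds hψ₂ (by simp)) (by simp)) (by simp)⟩

end Assoc

end Literature.Topology.FourManifolds
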